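import Mathlib

/-!
# Cone charts force a Hamiltonian 5-cycle in the link (G-free obstruction)

Negative-side helper for crux `CurvatureUniformityR` (stmt-QuantumFields-18154, route `HyperbolicRegulator`), refuter
`cdisprove`, 2026-08-17.  The cone-chart clause `CC` of `ConeTameSplit.TameCoreUniformityR` / `ConeChartsOfAdmissible`
(five injective quadrant charts `cK c s` around a degree-5 vertex `c`, chart-point function
`P c s a b = if a = 0 ∧ b = 0 then c else if a = 0 then cK c (s+1) (b,0) else cK c s (a,b)`) forces the five radial
neighbours `cK c s (1,0)` to be distinct neighbours of `c` with consecutive ones on a common square: a Hamiltonian 5-cycle in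
the "common square through `c`" relation on the link of `c`.  Hence a complex with a cone whose link is not a 5-cycle (e.g. the
pinch points `C₂ ⊔ C₃` of the admissible witness `X₈` of `Negative.coneChartsOfAdmissible_false`, p173245) admits no cone
charts, and every statement of the shape "admissible ⇒ cone charts exist" is refuted by it: cone charts must be DATA of the
family (restate advice R-b, `TameCoreUniformityR`).  Data-free, `G`-free, no `def`. [folklore]
-/

set_option autoImplicit false

namespace Summit.QuantumFields.YangMills.Theorems.CurvatureUniformityR.Negative

/-- **Cone charts force a Hamiltonian 5-cycle in the link.**  Let `P` be the chart-point function of the cone-chart clause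
`CC` (sector `s`, polar box coordinates `(a, b)`, `P c s 0 0 = c`, `P c s 0 b = cK c (s+1) (b, 0)`), and assume at the cone
`c` the three conjuncts of `CC` that are used: injectivity of `(s, a, b) ↦ cK c s (a, b)` on `1 ≤ a`, the radial adjacency
`P c s a b ~ P c s (a+1) b`, and the chart squares.  Then `n s := cK c s (1, 0)` is an injective family of five neighbours of
`c`, and for every `s` some square of `Q` passes through `c`, `n s` and `n (s+1)`.  Consequently NO complex having a cone whose
"common square through `c`" relation on its neighbours lacks a Hamiltonian 5-cycle admits cone charts — this is how `X₈`
(links `C₂ ⊔ C₃` at the pinch points) kills `ConeChartsOfAdmissible`, and it kills every future stub of the same shape. -/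
theorem cc_link_hamiltonian {Γ : SimpleGraph ℕ} {Q : Finset ℕ} {st : ℕ × Bool → ℕ} {bd : ℕ → Fin 4 → ℕ × Bool}
    {R : ℕ} (hR : 2 ≤ R) (c : ℕ) (cK : ℕ → Fin 5 → ℕ × ℕ → ℕ) (P : ℕ → Fin 5 → ℕ → ℕ → ℕ)
    (hP : ∀ c' s a b, P c' s a b = if a = 0 ∧ b = 0 then c' else if a = 0 then cK c' (s + 1) (b, 0) else cK c' s (a, b))
    (h3 : ∀ (s s' : Fin 5) (a a' b b' : ℕ), 1 ≤ a → a ≤ R → b ≤ R → 1 ≤ a' → a' ≤ R → b' ≤ R →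
      cK c s (a, b) = cK c s' (a', b') → s = s' ∧ a = a' ∧ b = b')
    (h4 : ∀ (s : Fin 5) (a b : ℕ), a + 1 ≤ R → b ≤ R → Γ.Adj (P c s a b) (P c s (a + 1) b))
    (h6 : ∀ (s : Fin 5) (a b : ℕ), a + 1 ≤ R → b + 1 ≤ R → ∃ q ∈ Q,
      Finset.univ.image (st ∘ bd q) = {P c s a b, P c s (a + 1) b, P c s a (b + 1), P c s (a + 1) (b + 1)}) :
    Function.Injective (fun s : Fin 5 => cK c s (1, 0)) ∧ (∀ s : Fin 5, Γ.Adj c (cK c s (1, 0))) ∧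
      ∀ s : Fin 5, ∃ q ∈ Q, c ∈ Finset.univ.image (st ∘ bd q) ∧ cK c s (1, 0) ∈ Finset.univ.image (st ∘ bd q) ∧
        cK c (s + 1) (1, 0) ∈ Finset.univ.image (st ∘ bd q) := by
  have hP00 : ∀ s, P c s 0 0 = c := fun s => by simp [hP]
  have hP10 : ∀ s, P c s 1 0 = cK c s (1, 0) := fun s => by simp [hP]
  have hP01 : ∀ s, P c s 0 1 = cK c (s + 1) (1, 0) := fun s => by simp [hP]
  refine ⟨?_, ?_, ?_⟩
  · intro s s' hss
    exact (h3 s s' 1 1 0 0 le_rfl (by omega) (Nat.zero_le _) le_rfl (by omega) (Nat.zero_le _) hss).1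
  · intro s
    have := h4 s 0 0 (by omega) (Nat.zero_le _)
    rwa [hP00, zero_add, hP10] at this
  · intro s
    obtain ⟨q, hq, himg⟩ := h6 s 0 0 (by omega) (by omega)
    rw [hP00, zero_add, hP10, hP01] at himg
    refine ⟨q, hq, ?_, ?_, ?_⟩ <;> simp [himg]

/-- **Corollary (the kill pattern).**  If the neighbours of a cone `c` all lie in a set `nb` enumerated by `nbl : Fin 5 → ℕ`,
the squares through `c` only realise the ordered neighbour pairs `good`, and `good` carries no Hamiltonian 5-cycle, then the
three used conjuncts of `CC` cannot hold at `c` for ANY `cK`. (Instantiated by `X₈` in the landed file.) -/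
theorem no_coneChart_of_no_hamiltonian {Γ : SimpleGraph ℕ} {Q : Finset ℕ} {st : ℕ × Bool → ℕ}
    {bd : ℕ → Fin 4 → ℕ × Bool} {R : ℕ} (hR : 2 ≤ R) (c : ℕ) (nb : Finset ℕ) (nbl : Fin 5 → ℕ) (good : Finset (ℕ × ℕ))
    (hnb : ∀ v, Γ.Adj c v → v ∈ nb) (hnbl : ∀ v ∈ nb, ∃ i, nbl i = v)
    (hsq : ∀ q ∈ Q, ∀ u ∈ nb, ∀ v ∈ nb, u ≠ v → c ∈ Finset.univ.image (st ∘ bd q) →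
      u ∈ Finset.univ.image (st ∘ bd q) → v ∈ Finset.univ.image (st ∘ bd q) → (u, v) ∈ good)
    (hham : ∀ g : Fin 5 → Fin 5, Function.Injective g → ¬ ∀ s : Fin 5, (nbl (g s), nbl (g (s + 1))) ∈ good)
    (cK : ℕ → Fin 5 → ℕ × ℕ → ℕ) (P : ℕ → Fin 5 → ℕ → ℕ → ℕ)
    (hP : ∀ c' s a b, P c' s a b = if a = 0 ∧ b = 0 then c' else if a = 0 then cK c' (s + 1) (b, 0) else cK c' s (a, b))
    (h3 : ∀ (s s' : Fin 5) (a a' b b' : ℕ), 1 ≤ a → a ≤ R → b ≤ R → 1 ≤ a' → a' ≤ R → b' ≤ R →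
      cK c s (a, b) = cK c s' (a', b') → s = s' ∧ a = a' ∧ b = b')
    (h4 : ∀ (s : Fin 5) (a b : ℕ), a + 1 ≤ R → b ≤ R → Γ.Adj (P c s a b) (P c s (a + 1) b))
    (h6 : ∀ (s : Fin 5) (a b : ℕ), a + 1 ≤ R → b + 1 ≤ R → ∃ q ∈ Q,
      Finset.univ.image (st ∘ bd q) = {P c s a b, P c s (a + 1) b, P c s a (b + 1), P c s (a + 1) (b + 1)}) :
    False := by
  obtain ⟨hinj, hadj, hsqs⟩ := cc_link_hamiltonian hR c cK P hP h3 h4 h6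
  have hmem : ∀ s : Fin 5, cK c s (1, 0) ∈ nb := fun s => hnb _ (hadj s)
  choose g hg using fun s => hnbl _ (hmem s)
  have ginj : Function.Injective g := fun s s' hss => hinj (by simp only; rw [← hg s, ← hg s', hss])
  have hne : ∀ s : Fin 5, s ≠ s + 1 := by decide
  refine hham g ginj fun s => ?_
  obtain ⟨q, hq, m0, m1, m2⟩ := hsqs s
  have h := hsq q hq _ (hmem s) _ (hmem (s + 1)) (fun heq => hne s (hinj heq)) m0 m1 m2
  rwa [← hg s, ← hg (s + 1)] at h

end Summit.QuantumFields.YangMills.Theorems.CurvatureUniformityR.Negative
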